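import Literature.MathematicalPhysics.QuantumLattice.GrassmannGaussianSources
import Literature.MathematicalPhysics.QuantumLattice.GrassmannIntegralCoefficients
import HarnessLib

/-!
# The addition principle for Gaussian Grassmann integrations (covariances add)

Trunk **QLatticeAQFT**; programme under `HubbardFermiLiquid.bgm_two_point_limit`
(Benfatto–Giuliani–Mastropietro 2006).  The multiscale analysis of BGM integrates the fermion
fields scale by scale; its algebraic engine is the **addition principle** (2.12) of loc. cit.:
if the propagator splits as `ĝ = ĝ^{(+1)} + ĝ^{(≤0)}` then
`∫P(dψ)e^{-V(ψ)} = ∫P(dψ^{(≤0)})∫P(dψ^{(+1)}) e^{-V(ψ^{(≤0)}+ψ^{(+1)})}` — the Gaussian Grassmann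
integration of covariance `g₁ + g₂` is the iterate of two independent ones acting on the sum field.
This file proves it for the finite-dimensional Berezin integral of `GrassmannIntegral*.lean`.

## Main results

* `berezinOn_gaussian_fieldSum` — in the Grassmann algebra on `J`, let two fermion
  families be placed by order embeddings `e₁ e₂ : ι ⊕ₗ ι ↪o J` (blocks `s₁` before `s₂`), with
  Gaussian weights `E₁ = e₁_*(e^{ψ̄A₁ψ})`, `E₂ = e₂_*(e^{ψ̄A₂ψ})` (`IsUnit (det Aᵢ)`), let
  `A⁻¹ = A₁⁻¹ + A₂⁻¹` with `IsUnit (det A)`, and let `Δ = map (1 + fieldShift e₁ e₂)` be the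
  substitution `ψ₁ ↦ ψ₁ + ψ₂` (`fieldShift`).  Then for every `g` in the algebra of the `ψ₁`-fields,
  `∫ dθ_{s₁∪s₂} E₁ E₂ (Δ g) = (ε det A₁ det A₂ (det A)⁻¹) • ∫ dθ_{s₁} e₁_*(e^{ψ̄Aψ}) g`,
  `ε = (-1)^{n(n-1)/2}`; dividing by the normalisations `∫ e^{ψ̄Bψ} = ε det B`
  (`berezin_grassmannExp_quadratic`) this is the normalised statement
  `⟨g(ψ₁ + ψ₂)⟩_{A₁⁻¹, A₂⁻¹} = ⟨g(ψ)⟩_{A₁⁻¹ + A₂⁻¹}` (BGM (2.12); Mastropietro 2008, (2.39));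
* `det_smul_berezinOn_gaussian_fieldSum` — the same with `det A` multiplied out (no `Ring.inverse`);
* `berezinOn_gaussian_fieldSum_of_sources` — the same with an explicit third, disjoint block `e₀`
  ("room for sources"), from which the former follows by embedding `J ↪o J ⊕ₗ (ι ⊕ₗ ι)`
  (`inlLex`, `inrLex`) and pulling back along the injective embedding of Grassmann algebras
  (`map_extendByZero_injective`, `berezinOn_map_map_extendByZero`,
  `map_extendByZero_map_one_add_fieldShift`, `map_extendByZero_mem_spectatorSubalgebra_compl`).

## Other results

* `fieldShift R e₁ e₂` (a `def`: the generator-space endomorphism `e_{e₁ k} ↦ e_{e₂ k}`) with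
  `fieldShift_apply`, `fieldShift_single_apply_range`, `fieldShift_single_of_not_mem`,
  `isSpectatorShift_fieldShift`, `map_one_add_fieldShift_gen_range` (`ψ₁ ↦ ψ₁ + ψ₂`),
  `map_one_add_fieldShift_gen_of_not_mem`;
* the source generating function: `swapLex`, `sourcePair R e₀ e x` (`η̄ᵢψᵢ`, `ηₖψ̄ₖ`),
  `sourcePairIdx`, `srcOf` (`def`s) with `prod_map_sourcePair`, `srcOf_injective`,
  `sum_sourcePair_eq`, `isNilpotent_sum_sourcePair`, `sum_sourcePair_mem_spectatorSubalgebra`, and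
  `exists_grassmannExp_sum_sourcePair` — **`e^{Σₓ sourcePair x} = Σ_M u_M θ_{src M} θ_{e₁ M}` with
  units `u_M`** (the source monomials of the expansion are distinct basis vectors);
* `GrassmannAlgebra.prod_map_gen_eq_neg_one_pow_smul` (a product of distinct generators in any
  order is `±` their monomial), `GrassmannAlgebra.spectatorSubalgebra_mono`,
  `commute_map_extend_grassmannExp_quadratic` (embedded Gaussian weights are central);
* transport along an order embedding `f : J ↪o J'` of all generators:
  `GrassmannAlgebra.extendByZero_comp`, `funLeft_comp_extendByZero`, `map_extendByZero_injective`,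
  `map_extendByZero_map_extendByZero`, `berezinSign_map`, `berezinOn_map_map_extendByZero`
  (`∫ dθ_{f(s)} f_* x = f_* ∫ dθ_s x`), `extendByZero_comp_fieldShift`.

## Sources

G. Benfatto, A. Giuliani, V. Mastropietro, Ann. Henri Poincaré 7 (2006) 809–898, §2.2, (2.11)–(2.12)
(arXiv p. 6 of the held copy `paper:arxiv-cond-mat_0507686`): "The definition of Grassmann
integration implies the following identity ("addition principle"):
`∫P(dψ)e^{-V(ψ)} = ∫P(dψ^{(≤0)})∫P(dψ^{(+1)}) e^{-V(ψ^{(≤0)}+ψ^{(+1)})}`"; bib key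
`BenfattoGiulianiMastropietro2006`.
V. Mastropietro, *Non-Perturbative Renormalization* (2008), §2.4 (1) "Addition property", (2.39),
PDF p. 35 of the held copy: "`∫P(dψ₁)∫P(dψ₂)F(ψ₁+ψ₂) = ∫P(dψ)F(ψ)`, where `P(dψ)` has covariance
`g ≡ g₁ + g₂`"; bib key `Mastropietro2008`.
M. Salmhofer, *Renormalization* (1999), App. B.3 (Gaussian integrals and their generating
functional, Lemma B.6), bib key `Salmhofer1999`, for the method of proof.

## Proof

Both sides are `R`-linear in `g`, `R`-linear over the source algebra (the sources are spectators of
`s₁ ∪ s₂`, the Gaussian weights are central), scalar on the monomials `θ_{e₁ M}`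
(`exists_berezinOn_eq_algebraMap`), and the substitution fixes the sources
(`IsSpectatorShift.map_eq_self_of_mem`).  On the generating function `X = e^{Σ(η̄ᵢψ₁ᵢ + ηᵢψ̄₁ᵢ)}`:
`Δ X = e^{S₁} e^{S₂}`, and by Fubini (`berezinOn_berezinOn_of_forall_lt`), linearity over
spectators and the Gaussian integral with sources (`GrassmannGaussianSources.lean`) twice, the left
side is `ε² det A₁ det A₂ e^{-η̄A₁⁻¹η} e^{-η̄A₂⁻¹η} = ε² det A₁ det A₂ e^{-η̄A⁻¹η}`, while the right
side is `c ε det A e^{-η̄A⁻¹η}`.  Expanding `X = Σ_M u_M θ_{src M} θ_{e₁ M}`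
(`exists_grassmannExp_sum_sourcePair`) turns the equality of the two functionals on `X` into
`Σ_M λ¹_M u_M θ_{src M} = Σ_M λ²_M u_M θ_{src M}`, and the coordinates of the basis vectors
`θ_{src M}` (`srcOf_injective`) give `λ¹_M = λ²_M` for every `M`, i.e. the claim on a spanning set.
-/

noncomputable section

/-! ## The addition principle for Gaussian Grassmann integrals -/

namespace Literature.MathematicalPhysics.QuantumLattice

section QLatticeAQFT

namespace GrassmannAlgebra

open ExteriorAlgebra

variable (R : Type*) [CommRing R] {κ : Type*} [LinearOrder κ] [Fintype κ]

/-- A product of distinct generators, in any order, is `±` the monomial of their set. [folklore] -/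
theorem prod_map_gen_eq_neg_one_pow_smul {l : List κ} (hl : l.Nodup) :
    ∃ k : ℕ, (l.map (gen R)).prod = (-1 : R) ^ k • grassmannBasis R κ l.toFinset := by
  induction l with
  | nil => exact ⟨0, by simp⟩
  | cons a l ih =>
    obtain ⟨k, hk⟩ := ih (List.nodup_cons.1 hl).2
    have ha : a ∉ l.toFinset := fun h => (List.nodup_cons.1 hl).1 (List.mem_toFinset.1 h)
    refine ⟨k + (l.toFinset.filter (· < a)).card, ?_⟩
    rw [List.map_cons, List.prod_cons, hk, mul_smul_comm, gen_mul_grassmannBasis_of_not_mem R ha,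
      smul_smul, ← pow_add, List.toFinset_cons]

/-- Spectator subalgebras are antitone in the block. [folklore] -/
theorem spectatorSubalgebra_mono {s s' : Finset κ} (h : s ⊆ s') :
    spectatorSubalgebra R s' ≤ spectatorSubalgebra R s := by
  intro x hx
  rw [mem_spectatorSubalgebra_iff] at hx ⊢
  refine Submodule.span_mono ?_ hx
  rintro _ ⟨u, hu, rfl⟩
  exact ⟨u, Finset.disjoint_of_subset_right h hu, rfl⟩

end GrassmannAlgebra

section FieldShift

open ExteriorAlgebra GrassmannAlgebra

variable (R : Type*) [CommRing R] {ι : Type*} [LinearOrder ι] [Fintype ι]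
  {J : Type*} [LinearOrder J] [Fintype J]

/-- The **field-sum shift**: the endomorphism of the generator space sending the basis vector of
`e₁ k` to that of `e₂ k` and killing all other basis vectors, so that the substitution
`1 + fieldShift e₁ e₂` is `ψ₁ ↦ ψ₁ + ψ₂` (and fixes every other generator): the map
`F(ψ) ↦ F(ψ₁ + ψ₂)` of the addition principle (BGM 2006, (2.12); Mastropietro 2008, (2.39)).
[folklore] -/
def fieldShift (e₁ e₂ : ι ⊕ₗ ι ↪o J) : Module.End R (J → R) :=
  ∑ k, (LinearMap.proj (e₁ k) : (J → R) →ₗ[R] R).smulRight (Pi.single (e₂ k) (1 : R))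

omit [Fintype J] in
/-- Unfolding `fieldShift`. [folklore] -/
theorem fieldShift_apply (e₁ e₂ : ι ⊕ₗ ι ↪o J) (w : J → R) :
    fieldShift R e₁ e₂ w = ∑ k, w (e₁ k) • (Pi.single (e₂ k) (1 : R) : J → R) := by
  simp only [fieldShift, LinearMap.sum_apply, LinearMap.smulRight_apply, LinearMap.proj_apply]

omit [Fintype J] in
/-- `fieldShift e₁ e₂` on the basis vector of `e₁ k`. [folklore] -/
theorem fieldShift_single_apply_range (e₁ e₂ : ι ⊕ₗ ι ↪o J) (k : ι ⊕ₗ ι) :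
    fieldShift R e₁ e₂ (Pi.single (e₁ k) 1) = Pi.single (e₂ k) 1 := by
  rw [fieldShift_apply]
  have h : ∀ k', (Pi.single (e₁ k) (1 : R) : J → R) (e₁ k') = if k' = k then 1 else 0 := by
    intro k'
    simp only [Pi.single_apply, EmbeddingLike.apply_eq_iff_eq]
  simp only [h, ite_smul, one_smul, zero_smul, Finset.sum_ite_eq', Finset.mem_univ, if_true]

omit [Fintype J] in
/-- `fieldShift e₁ e₂` kills the basis vectors outside the range of `e₁`. [folklore] -/
theorem fieldShift_single_of_not_mem (e₁ e₂ : ι ⊕ₗ ι ↪o J) {x : J}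
    (hx : x ∉ Finset.univ.map e₁.toEmbedding) : fieldShift R e₁ e₂ (Pi.single x 1) = 0 := by
  rw [fieldShift_apply]
  refine Finset.sum_eq_zero fun k _ => ?_
  rw [Pi.single_eq_of_ne (fun h : e₁ k = x => hx ?_), zero_smul]
  exact Finset.mem_map.2 ⟨k, Finset.mem_univ k, h⟩

omit [Fintype J] in
/-- For disjoint ranges, `fieldShift e₁ e₂` is a spectator shift of the `e₁`-block. [folklore] -/
theorem isSpectatorShift_fieldShift (e₁ e₂ : ι ⊕ₗ ι ↪o J)
    (h12 : Disjoint (Finset.univ.map e₁.toEmbedding) (Finset.univ.map e₂.toEmbedding)) :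
    IsSpectatorShift R (Finset.univ.map e₁.toEmbedding) (fieldShift R e₁ e₂) := by
  refine ⟨fun x hx => fieldShift_single_of_not_mem R e₁ e₂ hx, fun y x hx => ?_⟩
  rw [fieldShift_apply, Finset.sum_apply]
  refine Finset.sum_eq_zero fun k _ => ?_
  have hne : x ≠ e₂ k := fun h =>
    Finset.disjoint_left.1 h12 hx (Finset.mem_map.2 ⟨k, Finset.mem_univ k, h.symm⟩)
  rw [Pi.smul_apply, Pi.single_eq_of_ne hne, smul_zero]

omit [Fintype J] in
/-- The field-sum substitution on the generators of the first block: `ψ₁ ↦ ψ₁ + ψ₂`. [folklore] -/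
theorem map_one_add_fieldShift_gen_range (e₁ e₂ : ι ⊕ₗ ι ↪o J) (k : ι ⊕ₗ ι) :
    ExteriorAlgebra.map (1 + fieldShift R e₁ e₂) (gen R (e₁ k)) = gen R (e₁ k) + gen R (e₂ k) := by
  rw [map_one_add_gen, fieldShift_single_apply_range, gen, gen]

omit [Fintype J] in
/-- … and it fixes the other generators. [folklore] -/
theorem map_one_add_fieldShift_gen_of_not_mem (e₁ e₂ : ι ⊕ₗ ι ↪o J) {x : J}
    (hx : x ∉ Finset.univ.map e₁.toEmbedding) :
    ExteriorAlgebra.map (1 + fieldShift R e₁ e₂) (gen R x) = gen R x := by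
  rw [map_one_add_gen, fieldShift_single_of_not_mem R e₁ e₂ hx, map_zero, add_zero]

end FieldShift

/-! ### The source generating function and its expansion -/

section SourceExpansion

open ExteriorAlgebra GrassmannAlgebra

variable (R : Type*) [CommRing R] {ι : Type*} [LinearOrder ι] [Fintype ι]
  {J : Type*} [LinearOrder J] [Fintype J]

/-- Exchange of the two summands of `ι ⊕ₗ ι` (`ψ̄`-indices ↔ `ψ`-indices). [folklore] -/
def swapLex (x : ι ⊕ₗ ι) : ι ⊕ₗ ι := toLex (Sum.swap (ofLex x))

omit [LinearOrder ι] [Fintype ι] in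
/-- `swapLex` is injective. [folklore] -/
theorem swapLex_injective : Function.Injective (swapLex (ι := ι)) := by
  intro x y h
  have h1 : Sum.swap (ofLex x) = Sum.swap (ofLex y) := toLex_inj.1 h
  exact ofLex.injective (Sum.swap_leftInverse.injective h1)

/-- The **source pairing term** of the letter `x`: the source generator `θ_{e₀ (swap x)}` times the
field generator `θ_{e₁ x}` (`η̄ᵢ ψᵢ` for `x = inr i`, `ηₖ ψ̄ₖ` for `x = inl k`). [folklore] -/
def sourcePair (e₀ e₁ : ι ⊕ₗ ι ↪o J) (x : ι ⊕ₗ ι) : GrassmannAlgebra R J :=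
  gen R (e₀ (swapLex x)) * gen R (e₁ x)

omit [Fintype ι] [Fintype J] in
/-- Pairing terms are central. [folklore] -/
theorem commute_sourcePair (e₀ e₁ : ι ⊕ₗ ι ↪o J) (x : ι ⊕ₗ ι) (z : GrassmannAlgebra R J) :
    Commute (sourcePair R e₀ e₁ x) z :=
  commute_ι_mul_ι _ _ z

omit [Fintype ι] [Fintype J] in
/-- Pairing terms square to zero. [folklore] -/
theorem sourcePair_mul_self (e₀ e₁ : ι ⊕ₗ ι ↪o J) (x : ι ⊕ₗ ι) :
    sourcePair R e₀ e₁ x * sourcePair R e₀ e₁ x = 0 :=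
  ι_mul_ι_mul_self _ _

/-- The list of the two generator indices of `sourcePair x`. [folklore] -/
def sourcePairIdx (e₀ e₁ : ι ⊕ₗ ι ↪o J) (x : ι ⊕ₗ ι) : List J := [e₀ (swapLex x), e₁ x]

omit [Fintype ι] [Fintype J] in
/-- A product of pairing terms along a list is the product of the generators along the
concatenated index lists. [folklore] -/
theorem prod_map_sourcePair (e₀ e₁ : ι ⊕ₗ ι ↪o J) (l : List (ι ⊕ₗ ι)) :
    (l.map (sourcePair R e₀ e₁)).prod = ((l.flatMap (sourcePairIdx e₀ e₁)).map (gen R)).prod := by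
  induction l with
  | nil => simp
  | cons x l ih =>
    rw [List.map_cons, List.prod_cons, ih, List.flatMap_cons, List.map_append, List.prod_append]
    congr 1
    simp [sourcePairIdx, sourcePair]

/-- The source indices of a set of letters. [folklore] -/
def srcOf (e₀ : ι ⊕ₗ ι ↪o J) (M : Finset (ι ⊕ₗ ι)) : Finset J :=
  M.image fun x => e₀ (swapLex x)

omit [Fintype ι] [Fintype J] in
/-- Distinct sets of letters have distinct source sets. [folklore] -/
theorem srcOf_injective (e₀ : ι ⊕ₗ ι ↪o J) : Function.Injective (srcOf e₀) := by
  intro M N h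
  have hinj : Function.Injective fun x => e₀ (swapLex x) := e₀.injective.comp swapLex_injective
  rwa [srcOf, srcOf, (Finset.image_injective hinj).eq_iff] at h

variable [Algebra ℚ R]

/-- **Expansion of the source generating function**: with `S = Σₓ sourcePair x`,
`e^S = Σ_M u_M θ_{src M} θ_{e₁ M}` over all sets `M` of letters, with units `u_M = ±1`, provided the
sources and the fields live on disjoint sets of generators. [folklore] -/
theorem exists_grassmannExp_sum_sourcePair (e₀ e₁ : ι ⊕ₗ ι ↪o J)
    (h01 : Disjoint (Finset.univ.map e₀.toEmbedding) (Finset.univ.map e₁.toEmbedding)) :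
    ∃ u : Finset (ι ⊕ₗ ι) → R, (∀ M, IsUnit (u M)) ∧
      grassmannExp (∑ x, sourcePair R e₀ e₁ x) =
        ∑ M : Finset (ι ⊕ₗ ι), u M • (grassmannBasis R J (srcOf e₀ M) *
          grassmannBasis R J (M.map e₁.toEmbedding)) := by
  set s₁ := Finset.univ.map e₁.toEmbedding with hs₁
  have hne : ∀ x y : ι ⊕ₗ ι, e₀ x ≠ e₁ y := fun x y h =>
    Finset.disjoint_left.1 h01 (Finset.mem_map.2 ⟨x, Finset.mem_univ x, rfl⟩)
      (Finset.mem_map.2 ⟨y, Finset.mem_univ y, h.symm⟩)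
  have hsrc_sub : ∀ M : Finset (ι ⊕ₗ ι), srcOf e₀ M ⊆ Finset.univ.map e₀.toEmbedding := by
    intro M z hz
    obtain ⟨x, -, rfl⟩ := Finset.mem_image.1 hz
    exact Finset.mem_map.2 ⟨swapLex x, Finset.mem_univ _, rfl⟩
  have hmon_sub : ∀ M : Finset (ι ⊕ₗ ι), M.map e₁.toEmbedding ⊆ s₁ := fun M =>
    Finset.map_subset_map.2 (Finset.subset_univ M)
  -- each term of the expansion is a product of distinct generators
  have hterm : ∀ M : Finset (ι ⊕ₗ ι), ∃ u : R, IsUnit u ∧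
      M.noncommProd (sourcePair R e₀ e₁) (fun x _ y _ _ => commute_sourcePair R e₀ e₁ x _) =
        u • (grassmannBasis R J (srcOf e₀ M) * grassmannBasis R J (M.map e₁.toEmbedding)) := by
    intro M
    set l := M.toList with hl
    have hnodupM : l.Nodup := Finset.nodup_toList M
    have hnodup : (l.flatMap (sourcePairIdx e₀ e₁)).Nodup := by
      rw [List.nodup_flatMap]
      refine ⟨fun x _ => ?_, ?_⟩
      · simp only [sourcePairIdx, List.nodup_cons, List.mem_singleton, List.not_mem_nil,
          not_false_eq_true, List.nodup_nil, and_true]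
        exact hne _ _
      · refine hnodupM.imp fun {x y} hxy => ?_
        intro a ha hb
        simp only [sourcePairIdx, List.mem_cons, List.not_mem_nil, or_false] at ha hb
        rcases ha with rfl | rfl <;> rcases hb with h | h
        · exact hxy (swapLex_injective (e₀.injective h))
        · exact hne _ _ h
        · exact hne _ _ h.symm
        · exact hxy (e₁.injective h)
    obtain ⟨k, hk⟩ := prod_map_gen_eq_neg_one_pow_smul R hnodup
    have hprod : M.noncommProd (sourcePair R e₀ e₁) (fun x _ y _ _ => commute_sourcePair R e₀ e₁ x _) =
        (l.map (sourcePair R e₀ e₁)).prod :=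
      calc M.noncommProd (sourcePair R e₀ e₁) (fun x _ y _ _ => commute_sourcePair R e₀ e₁ x _)
          = l.toFinset.noncommProd (sourcePair R e₀ e₁)
              (fun x _ y _ _ => commute_sourcePair R e₀ e₁ x _) :=
            Finset.noncommProd_congr (Finset.toList_toFinset M).symm (fun _ _ => rfl) _
        _ = (l.map (sourcePair R e₀ e₁)).prod := Finset.noncommProd_toFinset l _ _ hnodupM
    have hset : (l.flatMap (sourcePairIdx e₀ e₁)).toFinset = srcOf e₀ M ∪ M.map e₁.toEmbedding := by
      ext z
      simp only [List.mem_toFinset, List.mem_flatMap, sourcePairIdx, List.mem_cons, List.not_mem_nil,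
        or_false, Finset.mem_union, srcOf, Finset.mem_image, hl, Finset.mem_toList]
      constructor
      · rintro ⟨x, hx, rfl | rfl⟩
        · exact Or.inl ⟨x, hx, rfl⟩
        · exact Or.inr (Finset.mem_map.2 ⟨x, hx, rfl⟩)
      · rintro (⟨x, hx, rfl⟩ | hz)
        · exact ⟨x, hx, Or.inl rfl⟩
        · obtain ⟨x, hx, rfl⟩ := Finset.mem_map.1 hz
          exact ⟨x, hx, Or.inr rfl⟩
    have hdisj : Disjoint (srcOf e₀ M) s₁ := Finset.disjoint_of_subset_left (hsrc_sub M) h01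
    have hsdiff : (srcOf e₀ M ∪ M.map e₁.toEmbedding) \ s₁ = srcOf e₀ M := by
      rw [Finset.union_sdiff_distrib, Finset.sdiff_eq_self_of_disjoint hdisj,
        Finset.sdiff_eq_empty_iff_subset.2 (hmon_sub M), Finset.union_empty]
    have hinter : (srcOf e₀ M ∪ M.map e₁.toEmbedding) ∩ s₁ = M.map e₁.toEmbedding := by
      rw [Finset.union_inter_distrib_right, Finset.disjoint_iff_inter_eq_empty.1 hdisj,
        Finset.empty_union, Finset.inter_eq_left.2 (hmon_sub M)]
    set ε := berezinSign ((srcOf e₀ M ∪ M.map e₁.toEmbedding) ∩ s₁)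
      (srcOf e₀ M ∪ M.map e₁.toEmbedding) with hε
    refine ⟨(-1 : R) ^ k * (((ε : ℤˣ) : ℤ) : R), ?_, ?_⟩
    · refine (isUnit_one.neg.pow k).mul (IsUnit.of_mul_eq_one (((ε : ℤˣ) : ℤ) : R) ?_)
      rw [← Int.cast_mul, ← Units.val_mul, Int.units_mul_self, Units.val_one, Int.cast_one]
    · rw [hprod, prod_map_sourcePair, hk, hset,
        grassmannBasis_eq_smul_sdiff_mul_inter R (srcOf e₀ M ∪ M.map e₁.toEmbedding) s₁, ← hε,
        smul_smul, hsdiff, hinter]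
  choose u hu using hterm
  refine ⟨u, fun M => (hu M).1, ?_⟩
  rw [grassmannExp, exp_sum_eq_sum_noncommProd (sourcePair R e₀ e₁) (commute_sourcePair R e₀ e₁)
    (sourcePair_mul_self R e₀ e₁) Finset.univ, Finset.powerset_univ]
  exact Finset.sum_congr rfl fun M _ => (hu M).2

omit [Fintype J] [Algebra ℚ R] in
/-- The source generating exponent in the form of `berezinOn_grassmannExp_quadratic_add_sources`:
`Σₓ sourcePair e₀ e x = Σᵢ (ι(ē_{e₀ inl i}) ψᵢ + ψ̄ᵢ ι(-e_{e₀ inr i}))`. [folklore] -/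
theorem sum_sourcePair_eq (e₀ e : ι ⊕ₗ ι ↪o J) :
    ∑ x, sourcePair R e₀ e x =
      ∑ i, (ExteriorAlgebra.ι R (Pi.single (e₀ (toLex (Sum.inl i))) (1 : R)) * gen R (e (toLex (Sum.inr i))) +
        gen R (e (toLex (Sum.inl i))) * ExteriorAlgebra.ι R (-(Pi.single (e₀ (toLex (Sum.inr i))) (1 : R)))) := by
  rw [← Fintype.sum_equiv toLex (fun x : ι ⊕ ι => sourcePair R e₀ e (toLex x)) (sourcePair R e₀ e)
      (fun _ => rfl), Fintype.sum_sum_type, ← Finset.sum_add_distrib]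
  refine Finset.sum_congr rfl fun i _ => ?_
  rw [add_comm (sourcePair R e₀ e (toLex (Sum.inl i)))]
  congr 1
  simp only [sourcePair, swapLex, ofLex_toLex, Sum.swap_inl, gen, map_neg, mul_neg]
  exact ι_mul_ι_eq_neg _ _

omit [Algebra ℚ R] [Fintype J] in
/-- The source generating exponent is nilpotent. [folklore] -/
theorem isNilpotent_sum_sourcePair (e₀ e : ι ⊕ₗ ι ↪o J) : IsNilpotent (∑ x, sourcePair R e₀ e x) :=
  Commute.isNilpotent_sum (fun _ _ => ⟨2, by rw [pow_two, sourcePair_mul_self]⟩)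
    fun x y _ _ => commute_sourcePair R e₀ e x _

omit [Algebra ℚ R] in
/-- The source generating exponent is a spectator away from its generators. [folklore] -/
theorem sum_sourcePair_mem_spectatorSubalgebra (e₀ e : ι ⊕ₗ ι ↪o J) {s : Finset J}
    (h₀ : ∀ x, e₀ x ∉ s) (h : ∀ x, e x ∉ s) :
    ∑ x, sourcePair R e₀ e x ∈ spectatorSubalgebra R s :=
  Subalgebra.sum_mem _ fun x _ => Subalgebra.mul_mem _ (gen_mem_spectatorSubalgebra R (h₀ (swapLex x)))
    (gen_mem_spectatorSubalgebra R (h x))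

omit [Fintype J] in
/-- The embedded Gaussian weight `e_*(e^{ψ̄Aψ})` is central. [folklore] -/
theorem commute_map_extend_grassmannExp_quadratic (e : ι ⊕ₗ ι ↪o J) (A : Matrix ι ι R)
    (z : GrassmannAlgebra R J) :
    Commute (ExteriorAlgebra.map (Function.ExtendByZero.linearMap R e) (grassmannExp (quadratic R A))) z := by
  rw [grassmannExp, IsNilpotent.map_exp (isNilpotent_quadratic R A)]
  refine commute_exp_of_forall_commute (fun z => commute_map_quadratic R _ A (fun x y z => ?_) z)
    ((isNilpotent_quadratic R A).map _) z
  rw [gen, gen, ExteriorAlgebra.map_apply_ι, ExteriorAlgebra.map_apply_ι]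
  exact commute_ι_mul_ι _ _ z

end SourceExpansion

/-! ### The addition principle -/

section AdditionPrinciple

open ExteriorAlgebra GrassmannAlgebra

variable (R : Type*) [CommRing R] [Algebra ℚ R] {ι : Type*} [LinearOrder ι] [Fintype ι]
  {J : Type*} [LinearOrder J] [Fintype J]

/-- **Addition principle for Gaussian Grassmann integrations** (Benfatto–Giuliani–Mastropietro
2006, (2.12): "`∫P(dψ)e^{-V(ψ)} = ∫P(dψ^{(≤0)})∫P(dψ^{(+1)}) e^{-V(ψ^{(≤0)}+ψ^{(+1)})}`", the
"addition principle" with `ĝ = ĝ^{(+1)} + ĝ^{(≤0)}`; Mastropietro 2008, (2.39): covariances add,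
`∫P(dψ₁)∫P(dψ₂) F(ψ₁+ψ₂) = ∫P(dψ)F(ψ)`, `g = g₁ + g₂`), in the un-normalised algebraic form and with
room for sources (`e₀`, used only in the proof): for two fermion blocks `ψ₁ = e₁(·)`, `ψ₂ = e₂(·)`
(`ψ₁` before `ψ₂`) with Gaussian weights `e^{ψ̄₁A₁ψ₁}`, `e^{ψ̄₂A₂ψ₂}`, covariances `A₁⁻¹`, `A₂⁻¹`, and
every `g` in the algebra of the `ψ₁`-fields,
`∫ dθ_{s₁∪s₂} e^{ψ̄₁A₁ψ₁} e^{ψ̄₂A₂ψ₂} g(ψ₁ + ψ₂) = (ε det A₁ det A₂ (det A)⁻¹) ∫ dθ_{s₁} e^{ψ̄₁Aψ₁} g(ψ₁)`,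
where `A⁻¹ = A₁⁻¹ + A₂⁻¹` and `ε = (-1)^{n(n-1)/2}`; dividing by the normalisations
(`berezin_grassmannExp_quadratic`: `∫e^{ψ̄Bψ} = ε det B`) this is `⟨g(ψ₁+ψ₂)⟩_{A₁⁻¹ ⊕ A₂⁻¹} =
⟨g⟩_{A⁻¹}`.  Proof: both sides are linear in `g`, linear over the source algebra and scalar on the
`ψ₁`-monomials; on the generating function `e^{Σ(η̄ψ₁ + ηψ̄₁)}` they agree by the Gaussian integral
with sources (completion of the square, twice on the left by Fubini, once on the right), and the
source monomials in its expansion are linearly independent. [cite: BenfattoGiulianiMastropietro2006, (2.12)] -/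
theorem berezinOn_gaussian_fieldSum_of_sources (e₀ e₁ e₂ : ι ⊕ₗ ι ↪o J)
    (h01 : Disjoint (Finset.univ.map e₀.toEmbedding) (Finset.univ.map e₁.toEmbedding))
    (h02 : Disjoint (Finset.univ.map e₀.toEmbedding) (Finset.univ.map e₂.toEmbedding))
    (h12 : ∀ x ∈ Finset.univ.map e₁.toEmbedding, ∀ y ∈ Finset.univ.map e₂.toEmbedding, x < y)
    (A₁ A₂ A : Matrix ι ι R) (hA₁ : IsUnit A₁.det) (hA₂ : IsUnit A₂.det) (hA : IsUnit A.det)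
    (hAinv : A⁻¹ = A₁⁻¹ + A₂⁻¹) {g : GrassmannAlgebra R J}
    (hg : g ∈ spectatorSubalgebra R (Finset.univ.map e₁.toEmbedding)ᶜ) :
    berezinOn R (Finset.univ.map e₁.toEmbedding ∪ Finset.univ.map e₂.toEmbedding)
        (ExteriorAlgebra.map (Function.ExtendByZero.linearMap R e₁) (grassmannExp (quadratic R A₁)) *
          ExteriorAlgebra.map (Function.ExtendByZero.linearMap R e₂) (grassmannExp (quadratic R A₂)) *
          ExteriorAlgebra.map (1 + fieldShift R e₁ e₂) g) =
      ((-1 : R) ^ (Fintype.card ι * (Fintype.card ι - 1) / 2) * A₁.det * A₂.det * Ring.inverse A.det) •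
        berezinOn R (Finset.univ.map e₁.toEmbedding)
          (ExteriorAlgebra.map (Function.ExtendByZero.linearMap R e₁) (grassmannExp (quadratic R A)) * g) := by
  -- Notation
  set t : Finset J := Finset.univ.map e₀.toEmbedding with ht
  set s₁ : Finset J := Finset.univ.map e₁.toEmbedding with hs₁
  set s₂ : Finset J := Finset.univ.map e₂.toEmbedding with hs₂
  set E₁ := ExteriorAlgebra.map (Function.ExtendByZero.linearMap R e₁) (grassmannExp (quadratic R A₁))
    with hE₁
  set E₂ := ExteriorAlgebra.map (Function.ExtendByZero.linearMap R e₂) (grassmannExp (quadratic R A₂))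
    with hE₂
  set EA := ExteriorAlgebra.map (Function.ExtendByZero.linearMap R e₁) (grassmannExp (quadratic R A))
    with hEA
  set Δ := ExteriorAlgebra.map (1 + fieldShift R e₁ e₂) with hΔ
  set εR : R := (-1 : R) ^ (Fintype.card ι * (Fintype.card ι - 1) / 2) with hεR
  set c : R := εR * A₁.det * A₂.det * Ring.inverse A.det with hc
  set L₁ : GrassmannAlgebra R J →ₗ[R] GrassmannAlgebra R J :=
    berezinOn R (s₁ ∪ s₂) ∘ₗ LinearMap.mulLeft R (E₁ * E₂) ∘ₗ Δ.toLinearMap with hL₁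
  set L₂ : GrassmannAlgebra R J →ₗ[R] GrassmannAlgebra R J :=
    c • (berezinOn R s₁ ∘ₗ LinearMap.mulLeft R EA) with hL₂
  have hL₁apply : ∀ y, L₁ y = berezinOn R (s₁ ∪ s₂) (E₁ * E₂ * Δ y) := fun y => rfl
  have hL₂apply : ∀ y, L₂ y = c • berezinOn R s₁ (EA * y) := fun y => rfl
  -- basic facts about the blocks
  have hmem₁ : ∀ {x}, x ∈ s₁ ↔ ∃ k, e₁ k = x := fun {x} => by simp [hs₁]
  have hmem₂ : ∀ {x}, x ∈ s₂ ↔ ∃ k, e₂ k = x := fun {x} => by simp [hs₂]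
  have hmem₀ : ∀ {x}, x ∈ t ↔ ∃ k, e₀ k = x := fun {x} => by simp [ht]
  have hd12 : Disjoint s₁ s₂ := Finset.disjoint_left.2 fun x hx hx' => lt_irrefl x (h12 x hx x hx')
  have he₁s₂ : ∀ k, e₁ k ∉ s₂ := fun k h => Finset.disjoint_left.1 hd12 (hmem₁.2 ⟨k, rfl⟩) h
  have he₂s₁ : ∀ k, e₂ k ∉ s₁ := fun k h => Finset.disjoint_left.1 hd12 h (hmem₂.2 ⟨k, rfl⟩)
  have he₀s₁ : ∀ k, e₀ k ∉ s₁ := fun k h => Finset.disjoint_left.1 h01 (hmem₀.2 ⟨k, rfl⟩) h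
  have he₀s₂ : ∀ k, e₀ k ∉ s₂ := fun k h => Finset.disjoint_left.1 h02 (hmem₀.2 ⟨k, rfl⟩) h
  have he₁c : ∀ k, e₁ k ∉ (s₁ ∪ s₂)ᶜ := fun k h =>
    (Finset.mem_compl.1 h) (Finset.mem_union_left _ (hmem₁.2 ⟨k, rfl⟩))
  have he₂c : ∀ k, e₂ k ∉ (s₁ ∪ s₂)ᶜ := fun k h =>
    (Finset.mem_compl.1 h) (Finset.mem_union_right _ (hmem₂.2 ⟨k, rfl⟩))
  have he₁c' : ∀ k, e₁ k ∉ s₁ᶜ := fun k h => (Finset.mem_compl.1 h) (hmem₁.2 ⟨k, rfl⟩)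
  have hshift : IsSpectatorShift R s₁ (fieldShift R e₁ e₂) := isSpectatorShift_fieldShift R e₁ e₂ hd12
  -- centrality and spectator properties of the weights
  have hcE₁ : ∀ z, Commute E₁ z := commute_map_extend_grassmannExp_quadratic R e₁ A₁
  have hcE₂ : ∀ z, Commute E₂ z := commute_map_extend_grassmannExp_quadratic R e₂ A₂
  have hcEA : ∀ z, Commute EA z := commute_map_extend_grassmannExp_quadratic R e₁ A
  have hE₁s₂ : E₁ ∈ spectatorSubalgebra R s₂ := map_extendByZero_mem_spectatorSubalgebra R e₁ he₁s₂ _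
  have hE₁c : E₁ ∈ spectatorSubalgebra R (s₁ ∪ s₂)ᶜ := map_extendByZero_mem_spectatorSubalgebra R e₁ he₁c _
  have hE₂c : E₂ ∈ spectatorSubalgebra R (s₁ ∪ s₂)ᶜ := map_extendByZero_mem_spectatorSubalgebra R e₂ he₂c _
  have hEAc : EA ∈ spectatorSubalgebra R s₁ᶜ := map_extendByZero_mem_spectatorSubalgebra R e₁ he₁c' _
  -- `Δ` preserves the algebra of the `ψ₁, ψ₂`-fields
  have hΔmem : ∀ {y}, y ∈ spectatorSubalgebra R (s₁ ∪ s₂)ᶜ → Δ y ∈ spectatorSubalgebra R (s₁ ∪ s₂)ᶜ := by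
    intro y hy
    rw [spectatorSubalgebra_eq_adjoin] at hy ⊢
    induction hy using Algebra.adjoin_induction with
    | mem x hx =>
      obtain ⟨i, hi, rfl⟩ := hx
      have hi' : i ∈ s₁ ∪ s₂ := by
        simpa only [Set.mem_setOf_eq, Finset.mem_compl, not_not] using hi
      rcases Finset.mem_union.1 hi' with hi₁ | hi₂
      · obtain ⟨k, rfl⟩ := hmem₁.1 hi₁
        rw [hΔ, map_one_add_fieldShift_gen_range]
        exact Subalgebra.add_mem _ (Algebra.subset_adjoin ⟨e₁ k, he₁c k, rfl⟩)
          (Algebra.subset_adjoin ⟨e₂ k, he₂c k, rfl⟩)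
      · rw [hΔ, map_one_add_fieldShift_gen_of_not_mem R e₁ e₂ (Finset.disjoint_right.1 hd12 hi₂)]
        exact Algebra.subset_adjoin ⟨i, hi, rfl⟩
    | algebraMap r => rw [AlgHom.commutes]; exact Subalgebra.algebraMap_mem _ r
    | mul x y _ _ hx hy => rw [map_mul]; exact Subalgebra.mul_mem _ hx hy
    | add x y _ _ hx hy => rw [map_add]; exact Subalgebra.add_mem _ hx hy
  -- Step 0: reduce to the monomials `θ_{e₁ M}`
  suffices key : ∀ M : Finset (ι ⊕ₗ ι),
      L₁ (grassmannBasis R J (M.map e₁.toEmbedding)) = L₂ (grassmannBasis R J (M.map e₁.toEmbedding)) by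
    have hlin : L₁ g = L₂ g := by
      rw [mem_spectatorSubalgebra_iff] at hg
      induction hg using Submodule.span_induction with
      | mem x hx =>
        obtain ⟨u, hu, rfl⟩ := hx
        have hus : u ⊆ s₁ := fun x hx => by
          by_contra h
          exact Finset.disjoint_left.1 hu hx (Finset.mem_compl.2 h)
        obtain ⟨M, -, rfl⟩ := Finset.subset_map_iff.1 hus
        exact key M
      | zero => rw [map_zero, map_zero]
      | add x y _ _ hx hy => rw [map_add, map_add, hx, hy]
      | smul r x _ hx => rw [map_smul, map_smul, hx]
    rw [hL₁apply, hL₂apply] at hlin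
    rw [mul_assoc] at hlin ⊢
    exact hlin
  -- the source generating function and its expansion
  set S₁ := ∑ x, sourcePair R e₀ e₁ x with hS₁
  set S₂ := ∑ x, sourcePair R e₀ e₂ x with hS₂
  obtain ⟨u, hu, hexpand⟩ := exists_grassmannExp_sum_sourcePair R e₀ e₁ h01
  have hsrc_t : ∀ M, Disjoint (srcOf e₀ M) (s₁ ∪ s₂) := by
    intro M
    refine Finset.disjoint_left.2 fun z hz hz' => ?_
    obtain ⟨x, -, rfl⟩ := Finset.mem_image.1 hz
    rcases Finset.mem_union.1 hz' with h | h
    · exact he₀s₁ _ h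
    · exact he₀s₂ _ h
  have hsrc_spec : ∀ M, grassmannBasis R J (srcOf e₀ M) ∈ spectatorSubalgebra R (s₁ ∪ s₂) :=
    fun M => grassmannBasis_mem_spectatorSubalgebra R (hsrc_t M)
  have hsrc_spec₁ : ∀ M, grassmannBasis R J (srcOf e₀ M) ∈ spectatorSubalgebra R s₁ :=
    fun M => spectatorSubalgebra_mono R Finset.subset_union_left (hsrc_spec M)
  have hmon_mem : ∀ M : Finset (ι ⊕ₗ ι),
      grassmannBasis R J (M.map e₁.toEmbedding) ∈ spectatorSubalgebra R (s₁ ∪ s₂)ᶜ := by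
    intro M
    refine grassmannBasis_mem_spectatorSubalgebra R (Finset.disjoint_left.2 fun z hz hz' => ?_)
    exact (Finset.mem_compl.1 hz') (Finset.mem_union_left _ (Finset.map_subset_map.2 (Finset.subset_univ M) hz))
  have hmon_mem₁ : ∀ M : Finset (ι ⊕ₗ ι),
      grassmannBasis R J (M.map e₁.toEmbedding) ∈ spectatorSubalgebra R s₁ᶜ := by
    intro M
    refine grassmannBasis_mem_spectatorSubalgebra R (Finset.disjoint_left.2 fun z hz hz' => ?_)
    exact (Finset.mem_compl.1 hz') (Finset.map_subset_map.2 (Finset.subset_univ M) hz)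
  -- Step A: both functionals expand along the source monomials
  have hL₁sum : L₁ (grassmannExp S₁) = ∑ M, u M • (grassmannBasis R J (srcOf e₀ M) *
      L₁ (grassmannBasis R J (M.map e₁.toEmbedding))) := by
    rw [hexpand, map_sum]
    refine Finset.sum_congr rfl fun M _ => ?_
    rw [map_smul, hL₁apply, hL₁apply, hΔ, map_mul (ExteriorAlgebra.map _),
      hshift.map_eq_self_of_mem R (hsrc_spec₁ M), ← mul_assoc, ((hcE₁ _).mul_left (hcE₂ _)).eq, mul_assoc,
      berezinOn_mul_of_mem_spectatorSubalgebra R (hsrc_spec M)]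
  have hL₂sum : L₂ (grassmannExp S₁) = ∑ M, u M • (grassmannBasis R J (srcOf e₀ M) *
      L₂ (grassmannBasis R J (M.map e₁.toEmbedding))) := by
    rw [hexpand, map_sum]
    refine Finset.sum_congr rfl fun M _ => ?_
    rw [map_smul, hL₂apply, hL₂apply, ← mul_assoc, (hcEA _).eq, mul_assoc,
      berezinOn_mul_of_mem_spectatorSubalgebra R (hsrc_spec₁ M), mul_smul_comm]
  -- Step B: the values on the monomials are scalars
  have hval₁ : ∀ M : Finset (ι ⊕ₗ ι), ∃ r : R,
      L₁ (grassmannBasis R J (M.map e₁.toEmbedding)) = algebraMap R _ r := by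
    intro M
    rw [hL₁apply]
    exact exists_berezinOn_eq_algebraMap R
      (Subalgebra.mul_mem _ (Subalgebra.mul_mem _ hE₁c hE₂c) (hΔmem (hmon_mem M)))
  have hval₂ : ∀ M : Finset (ι ⊕ₗ ι), ∃ r : R,
      L₂ (grassmannBasis R J (M.map e₁.toEmbedding)) = algebraMap R _ r := by
    intro M
    rw [hL₂apply]
    obtain ⟨r, hr⟩ := exists_berezinOn_eq_algebraMap R (Subalgebra.mul_mem _ hEAc (hmon_mem₁ M))
    exact ⟨c * r, by rw [hr, map_mul, Algebra.smul_def]⟩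
  choose r₁ hr₁ using hval₁
  choose r₂ hr₂ using hval₂
  -- Step C: the Gaussian identity on the generating function
  have hGF : L₁ (grassmannExp S₁) = L₂ (grassmannExp S₁) := by
    -- the sources as vectors
    set vbar : ι → J → R := fun i => Pi.single (e₀ (toLex (Sum.inl i))) 1 with hvbar
    set v : ι → J → R := fun i => -(Pi.single (e₀ (toLex (Sum.inr i))) (1 : R)) with hv
    have hne₁ : ∀ x k, e₁ k ≠ e₀ x := fun x k h => he₀s₁ x (h ▸ hmem₁.2 ⟨k, rfl⟩)
    have hne₂ : ∀ x k, e₂ k ≠ e₀ x := fun x k h => he₀s₂ x (h ▸ hmem₂.2 ⟨k, rfl⟩)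
    have hvbar₁ : ∀ i k, vbar i (e₁ k) = 0 := fun i k => Pi.single_eq_of_ne (hne₁ _ k) _
    have hv₁ : ∀ i k, v i (e₁ k) = 0 := fun i k => by
      rw [hv]; dsimp only; rw [Pi.neg_apply, Pi.single_eq_of_ne (hne₁ _ k), neg_zero]
    have hvbar₂ : ∀ i k, vbar i (e₂ k) = 0 := fun i k => Pi.single_eq_of_ne (hne₂ _ k) _
    have hv₂ : ∀ i k, v i (e₂ k) = 0 := fun i k => by
      rw [hv]; dsimp only; rw [Pi.neg_apply, Pi.single_eq_of_ne (hne₂ _ k), neg_zero]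
    have hvbar₁' : ∀ i, ∀ x ∈ s₁, vbar i x = 0 := fun i x hx => by
      obtain ⟨k, rfl⟩ := hmem₁.1 hx; exact hvbar₁ i k
    have hv₁' : ∀ i, ∀ x ∈ s₁, v i x = 0 := fun i x hx => by
      obtain ⟨k, rfl⟩ := hmem₁.1 hx; exact hv₁ i k
    -- the quadratic source terms `T B = Σ B⁻¹ᵢⱼ b̄ᵢ bⱼ`
    set T : Matrix ι ι R → GrassmannAlgebra R J := fun B =>
      ∑ i, ∑ j, B⁻¹ i j • (ExteriorAlgebra.ι R (vbar i) * ExteriorAlgebra.ι R (v j)) with hT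
    have hnT : ∀ B, IsNilpotent (T B) := fun B => isNilpotent_sum_sum_smul_ι_mul_ι B⁻¹ vbar v
    have hcT : ∀ B z, Commute (T B) z := fun B z => commute_sum_sum_smul_ι_mul_ι B⁻¹ vbar v z
    have hTmem : ∀ B, T B ∈ spectatorSubalgebra R s₁ := fun B =>
      Subalgebra.sum_mem _ fun i _ => Subalgebra.sum_mem _ fun j _ => Subalgebra.smul_mem _
        (Subalgebra.mul_mem _ (ι_mem_spectatorSubalgebra R (hvbar₁' i))
          (ι_mem_spectatorSubalgebra R (hv₁' j))) _
    have hTsum : T A₁ + T A₂ = T A := by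
      simp only [hT, hAinv, Matrix.add_apply, add_smul, Finset.sum_add_distrib]
    have hexpT : grassmannExp (-T A₁) * grassmannExp (-T A₂) = grassmannExp (-T A) := by
      simp only [grassmannExp]
      rw [← IsNilpotent.exp_add_of_commute (hcT A₁ (T A₂)).neg_left.neg_right (hnT A₁).neg (hnT A₂).neg,
        ← neg_add, hTsum]
    -- the generating exponents in the form of the sources lemma
    have hS₁eq := sum_sourcePair_eq R e₀ e₁
    have hS₂eq := sum_sourcePair_eq R e₀ e₂
    have hG₁ : berezinOn R s₁ (E₁ * grassmannExp S₁) = (εR * A₁.det) • grassmannExp (-T A₁) := by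
      rw [hS₁, hS₁eq]
      exact berezinOn_map_grassmannExp_quadratic_mul_grassmannExp_sources R e₁ A₁ hA₁ vbar v hvbar₁ hv₁
    have hG₂ : berezinOn R s₂ (E₂ * grassmannExp S₂) = (εR * A₂.det) • grassmannExp (-T A₂) := by
      rw [hS₂, hS₂eq]
      exact berezinOn_map_grassmannExp_quadratic_mul_grassmannExp_sources R e₂ A₂ hA₂ vbar v hvbar₂ hv₂
    have hGA : berezinOn R s₁ (EA * grassmannExp S₁) = (εR * A.det) • grassmannExp (-T A) := by
      rw [hS₁, hS₁eq]
      exact berezinOn_map_grassmannExp_quadratic_mul_grassmannExp_sources R e₁ A hA vbar v hvbar₁ hv₁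
    -- `Δ (exp S₁) = exp S₁ · exp S₂`
    have hnS₁ : IsNilpotent S₁ := isNilpotent_sum_sourcePair R e₀ e₁
    have hnS₂ : IsNilpotent S₂ := isNilpotent_sum_sourcePair R e₀ e₂
    have hcS₂ : ∀ z, Commute S₂ z := fun z =>
      Commute.sum_left _ _ _ fun x _ => commute_sourcePair R e₀ e₂ x z
    have hΔS : Δ S₁ = S₁ + S₂ := by
      rw [hΔ, hS₁, hS₂, map_sum, ← Finset.sum_add_distrib]
      refine Finset.sum_congr rfl fun x _ => ?_
      simp only [sourcePair, map_mul, map_one_add_fieldShift_gen_of_not_mem R e₁ e₂ (he₀s₁ _),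
        map_one_add_fieldShift_gen_range, mul_add]
    have hΔexp : Δ (grassmannExp S₁) = grassmannExp S₁ * grassmannExp S₂ := by
      simp only [grassmannExp]
      rw [IsNilpotent.map_exp hnS₁, hΔS, IsNilpotent.exp_add_of_commute (hcS₂ S₁).symm hnS₁ hnS₂]
    -- spectator / centrality facts
    have hX₁s₂ : grassmannExp S₁ ∈ spectatorSubalgebra R s₂ :=
      exp_mem_of_mem (sum_sourcePair_mem_spectatorSubalgebra R e₀ e₁ he₀s₂ he₁s₂) hnS₁
    have hG₂spec : grassmannExp (-T A₂) ∈ spectatorSubalgebra R s₁ :=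
      exp_mem_of_mem (Subalgebra.neg_mem _ (hTmem A₂)) (hnT A₂).neg
    have hG₂c : ∀ z, Commute (grassmannExp (-T A₂)) z :=
      commute_exp_of_forall_commute (fun z => (hcT A₂ z).neg_left) (hnT A₂).neg
    -- the scalar identity
    have hcd : εR * A₂.det * (εR * A₁.det) = c * (εR * A.det) := by
      rw [hc]
      linear_combination (-(εR * εR * A₁.det * A₂.det)) * Ring.inverse_mul_cancel A.det hA
    -- compute
    calc L₁ (grassmannExp S₁)
        = berezinOn R (s₁ ∪ s₂) (E₁ * E₂ * (grassmannExp S₁ * grassmannExp S₂)) := by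
          rw [hL₁apply, hΔexp]
      _ = berezinOn R s₁ (berezinOn R s₂ (E₁ * grassmannExp S₁ * (E₂ * grassmannExp S₂))) := by
          rw [← berezinOn_berezinOn_of_forall_lt R h12, mul_assoc, ← mul_assoc E₂,
            (hcE₂ (grassmannExp S₁)).eq, mul_assoc (grassmannExp S₁), ← mul_assoc]
      _ = berezinOn R s₁ (E₁ * grassmannExp S₁ * berezinOn R s₂ (E₂ * grassmannExp S₂)) := by
          rw [berezinOn_mul_of_mem_spectatorSubalgebra R (Subalgebra.mul_mem _ hE₁s₂ hX₁s₂)]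
      _ = (εR * A₂.det) • (berezinOn R s₁ (E₁ * grassmannExp S₁) * grassmannExp (-T A₂)) := by
          rw [hG₂, mul_smul_comm, map_smul,
            berezinOn_mul_of_mem_spectatorSubalgebra_of_commute R hG₂spec hG₂c]
      _ = (εR * A₂.det * (εR * A₁.det)) • grassmannExp (-T A) := by
          rw [hG₁, smul_mul_assoc, smul_smul, hexpT]
      _ = L₂ (grassmannExp S₁) := by
          rw [hL₂apply, hGA, smul_smul, hcd]
  -- Step D: compare coefficients of the source monomials
  have hsum : ∑ M, (r₁ M * u M) • grassmannBasis R J (srcOf e₀ M) =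
      ∑ M, (r₂ M * u M) • grassmannBasis R J (srcOf e₀ M) := by
    have h1 : ∀ M, u M • (grassmannBasis R J (srcOf e₀ M) * L₁ (grassmannBasis R J (M.map e₁.toEmbedding))) =
        (r₁ M * u M) • grassmannBasis R J (srcOf e₀ M) := fun M => by
      rw [hr₁, ← Algebra.commutes, ← Algebra.smul_def, smul_smul, mul_comm]
    have h2 : ∀ M, u M • (grassmannBasis R J (srcOf e₀ M) * L₂ (grassmannBasis R J (M.map e₁.toEmbedding))) =
        (r₂ M * u M) • grassmannBasis R J (srcOf e₀ M) := fun M => by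
      rw [hr₂, ← Algebra.commutes, ← Algebra.smul_def, smul_smul, mul_comm]
    have h := hGF
    rw [hL₁sum, hL₂sum] at h
    simpa only [h1, h2] using h
  have hcoef : ∀ M, r₁ M = r₂ M := by
    intro M₀
    have h := congrArg ((grassmannBasis R J).coord (srcOf e₀ M₀)) hsum
    simp only [map_sum, map_smul, Module.Basis.coord_apply, Module.Basis.repr_self,
      Finsupp.single_apply, (srcOf_injective e₀).eq_iff, smul_eq_mul, mul_ite, mul_one, mul_zero,
      Finset.sum_ite_eq', Finset.mem_univ, if_true] at h
    exact (hu M₀).mul_left_injective h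
  intro M
  rw [hr₁, hr₂, hcoef]

end AdditionPrinciple



end QLatticeAQFT

end Literature.MathematicalPhysics.QuantumLattice

/-! ### Transport along an order embedding of all generators; removing the source room -/

namespace Literature.MathematicalPhysics.QuantumLattice

section QLatticeAQFT

namespace GrassmannAlgebra

open ExteriorAlgebra

variable (R : Type*) [CommRing R] {κ : Type*} [LinearOrder κ] [Fintype κ]
  {J : Type*} [LinearOrder J] [Fintype J] {J' : Type*} [LinearOrder J'] [Fintype J']

omit [LinearOrder κ] [Fintype κ] [LinearOrder J] [Fintype J] [LinearOrder J'] [Fintype J'] in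
/-- Extension by zero is functorial along injections. [folklore] -/
theorem extendByZero_comp {e : κ → J} {f : J → J'} (he : Function.Injective e) (hf : Function.Injective f) :
    Function.ExtendByZero.linearMap R f ∘ₗ Function.ExtendByZero.linearMap R e =
      Function.ExtendByZero.linearMap R (f ∘ e) := by
  ext v y
  change Function.extend f (Function.extend e v 0) 0 y = Function.extend (f ∘ e) v 0 y
  by_cases hy : ∃ x, f x = y
  · obtain ⟨x, rfl⟩ := hy
    rw [hf.extend_apply]
    by_cases hx : ∃ k, e k = x
    · obtain ⟨k, rfl⟩ := hx
      rw [he.extend_apply]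
      exact ((hf.comp he).extend_apply v 0 k).symm
    · rw [Function.extend_apply' _ _ _ hx,
        Function.extend_apply' (f := f ∘ e) v 0 (f x) fun ⟨k, hk⟩ => hx ⟨k, hf hk⟩]
      rfl
  · rw [Function.extend_apply' _ _ _ hy,
      Function.extend_apply' (f := f ∘ e) v 0 y fun ⟨k, hk⟩ => hy ⟨e k, hk⟩]

omit [LinearOrder κ] [Fintype κ] [LinearOrder J] [Fintype J] [LinearOrder J'] [Fintype J'] in
/-- Restriction is a left inverse of extension by zero. [folklore] -/
theorem funLeft_comp_extendByZero {f : J → J'} (hf : Function.Injective f) :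
    LinearMap.funLeft R R f ∘ₗ Function.ExtendByZero.linearMap R f = LinearMap.id := by
  ext v x
  change Function.extend f v 0 (f x) = v x
  exact hf.extend_apply _ _ _

omit [LinearOrder κ] [Fintype κ] [LinearOrder J] [Fintype J] [LinearOrder J'] [Fintype J'] in
/-- The embedding of Grassmann algebras along an injection of generators is injective. [folklore] -/
theorem map_extendByZero_injective {f : J → J'} (hf : Function.Injective f) :
    Function.Injective (ExteriorAlgebra.map (Function.ExtendByZero.linearMap R f)) := by
  intro x y h
  have h' := congrArg (ExteriorAlgebra.map (LinearMap.funLeft R R f)) h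
  rwa [← AlgHom.comp_apply, ← AlgHom.comp_apply, ExteriorAlgebra.map_comp_map,
    funLeft_comp_extendByZero R hf, ExteriorAlgebra.map_id, AlgHom.id_apply, AlgHom.id_apply] at h'

omit [Fintype κ] [Fintype J] [Fintype J'] in
/-- Composition of the embeddings along `e : κ ↪o J` and `f : J ↪o J'`. [folklore] -/
theorem map_extendByZero_map_extendByZero (e : κ ↪o J) (f : J ↪o J') (x : GrassmannAlgebra R κ) :
    ExteriorAlgebra.map (Function.ExtendByZero.linearMap R f)
        (ExteriorAlgebra.map (Function.ExtendByZero.linearMap R e) x) =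
      ExteriorAlgebra.map (Function.ExtendByZero.linearMap R (e.trans f)) x := by
  rw [← AlgHom.comp_apply, ExteriorAlgebra.map_comp_map, extendByZero_comp R e.injective f.injective]
  rfl

omit [LinearOrder κ] [Fintype κ] [Fintype J] [Fintype J'] in
/-- The shuffle sign is invariant under an order embedding. [folklore] -/
theorem berezinSign_map (f : J ↪o J') (s t : Finset J) :
    berezinSign (s.map f.toEmbedding) (t.map f.toEmbedding) = berezinSign s t := by
  rw [berezinSign, berezinSign, ← Finset.map_sdiff, ← Finset.prodMap_map_product, Finset.filter_map,
    Finset.card_map]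
  congr 2
  refine Finset.filter_congr fun p _ => ?_
  simp only [Function.comp_apply, Function.Embedding.coe_prodMap, RelEmbedding.coe_toEmbedding,
    Prod.map_fst, Prod.map_snd, f.lt_iff_lt]

omit [LinearOrder κ] [Fintype κ] in
/-- **Transport of partial Berezin integration along an order embedding of generators**:
`∫ dθ_{f(s)} (f_* x) = f_* (∫ dθ_s x)`. [folklore] -/
theorem berezinOn_map_map_extendByZero (f : J ↪o J') (s : Finset J) (x : GrassmannAlgebra R J) :
    berezinOn R (s.map f.toEmbedding) (ExteriorAlgebra.map (Function.ExtendByZero.linearMap R f) x) =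
      ExteriorAlgebra.map (Function.ExtendByZero.linearMap R f) (berezinOn R s x) := by
  suffices h : berezinOn R (s.map f.toEmbedding) ∘ₗ
      (ExteriorAlgebra.map (Function.ExtendByZero.linearMap R f)).toLinearMap =
        (ExteriorAlgebra.map (Function.ExtendByZero.linearMap R f)).toLinearMap ∘ₗ berezinOn R s from
    LinearMap.congr_fun h x
  refine (grassmannBasis R J).ext fun t => ?_
  rw [LinearMap.comp_apply, LinearMap.comp_apply, AlgHom.toLinearMap_apply, AlgHom.toLinearMap_apply,
    map_extendByZero_grassmannBasis, berezinOn_grassmannBasis, berezinOn_grassmannBasis]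
  by_cases hst : s ⊆ t
  · rw [if_pos (Finset.map_subset_map.2 hst), if_pos hst, map_smul, map_extendByZero_grassmannBasis,
      Finset.map_sdiff, berezinSign_map]
  · rw [if_neg (fun h => hst (Finset.map_subset_map.1 h)), if_neg hst, map_zero]

omit [Fintype κ] [LinearOrder J] [Fintype J] [LinearOrder J'] [Fintype J'] in
/-- The embedding maps the algebra of the `s`-fields into the algebra of the `f(s)`-fields.
[folklore] -/
theorem map_extendByZero_mem_spectatorSubalgebra_compl [LinearOrder J] [Fintype J] [LinearOrder J']
    [Fintype J'] (f : J ↪o J') {s : Finset J} {x : GrassmannAlgebra R J}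
    (hx : x ∈ spectatorSubalgebra R sᶜ) :
    ExteriorAlgebra.map (Function.ExtendByZero.linearMap R f) x ∈
      spectatorSubalgebra R (s.map f.toEmbedding)ᶜ := by
  rw [spectatorSubalgebra_eq_adjoin] at hx ⊢
  have h : (Algebra.adjoin R (gen R '' {i | i ∉ sᶜ})).map
      (ExteriorAlgebra.map (Function.ExtendByZero.linearMap R f)) ≤
      Algebra.adjoin R (gen R '' {i | i ∉ (s.map f.toEmbedding)ᶜ}) := by
    rw [AlgHom.map_adjoin]
    refine Algebra.adjoin_le ?_
    rintro _ ⟨_, ⟨i, hi, rfl⟩, rfl⟩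
    rw [map_extendByZero_gen, SetLike.mem_coe]
    refine Algebra.subset_adjoin ⟨f i, ?_, rfl⟩
    simp only [Set.mem_setOf_eq, Finset.mem_compl, not_not] at hi ⊢
    exact Finset.mem_map.2 ⟨i, hi, rfl⟩
  exact h (Subalgebra.mem_map.2 ⟨x, hx, rfl⟩)

end GrassmannAlgebra

section Transport

open ExteriorAlgebra GrassmannAlgebra

variable (R : Type*) [CommRing R] {ι : Type*} [LinearOrder ι] [Fintype ι]
  {J : Type*} [LinearOrder J] [Fintype J] {J' : Type*} [LinearOrder J'] [Fintype J']

omit [Fintype J'] in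
/-- The field-sum shift is transported by an order embedding of all generators. [folklore] -/
theorem extendByZero_comp_fieldShift (e₁ e₂ : ι ⊕ₗ ι ↪o J) (f : J ↪o J') :
    Function.ExtendByZero.linearMap R f ∘ₗ (1 + fieldShift R e₁ e₂) =
      (1 + fieldShift R (e₁.trans f) (e₂.trans f)) ∘ₗ Function.ExtendByZero.linearMap R f := by
  refine (Pi.basisFun R J).ext fun x => ?_
  rw [LinearMap.comp_apply, LinearMap.comp_apply, Pi.basisFun_apply, LinearMap.add_apply,
    LinearMap.add_apply, Module.End.one_apply, Module.End.one_apply, map_add, extendByZero_single]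
  congr 1
  rw [fieldShift_apply, fieldShift_apply, map_sum]
  refine Finset.sum_congr rfl fun k _ => ?_
  rw [map_smul, extendByZero_single]
  congr 1
  change (Pi.single x (1 : R) : J → R) (e₁ k) = (Pi.single (f x) (1 : R) : J' → R) (f (e₁ k))
  simp only [Pi.single_apply, EmbeddingLike.apply_eq_iff_eq]

omit [Fintype J'] in
/-- … hence so is the substitution `ψ₁ ↦ ψ₁ + ψ₂`. [folklore] -/
theorem map_extendByZero_map_one_add_fieldShift (e₁ e₂ : ι ⊕ₗ ι ↪o J) (f : J ↪o J')
    (x : GrassmannAlgebra R J) :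
    ExteriorAlgebra.map (Function.ExtendByZero.linearMap R f) (ExteriorAlgebra.map (1 + fieldShift R e₁ e₂) x) =
      ExteriorAlgebra.map (1 + fieldShift R (e₁.trans f) (e₂.trans f))
        (ExteriorAlgebra.map (Function.ExtendByZero.linearMap R f) x) := by
  rw [← AlgHom.comp_apply, ← AlgHom.comp_apply, ExteriorAlgebra.map_comp_map, ExteriorAlgebra.map_comp_map,
    extendByZero_comp_fieldShift]

/-- The order embedding of `J` as the first summand of `J ⊕ₗ K`. [folklore] -/
def inlLex (J K : Type*) [LinearOrder J] [LinearOrder K] : J ↪o J ⊕ₗ K :=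
  OrderEmbedding.ofStrictMono (fun x => toLex (Sum.inl x)) fun _ _ h => Sum.Lex.inl_lt_inl_iff.2 h

/-- The order embedding of `K` as the second summand of `J ⊕ₗ K`. [folklore] -/
def inrLex (J K : Type*) [LinearOrder J] [LinearOrder K] : K ↪o J ⊕ₗ K :=
  OrderEmbedding.ofStrictMono (fun x => toLex (Sum.inr x)) fun _ _ h => Sum.Lex.inr_lt_inr_iff.2 h

omit [Fintype J] in
/-- The source summand is disjoint from the transported fermion blocks. [folklore] -/
theorem disjoint_map_inrLex_map_trans_inlLex (e : ι ⊕ₗ ι ↪o J) :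
    Disjoint (Finset.univ.map (inrLex J (ι ⊕ₗ ι)).toEmbedding)
      (Finset.univ.map (e.trans (inlLex J (ι ⊕ₗ ι))).toEmbedding) := by
  refine Finset.disjoint_left.2 fun z hz hz' => ?_
  obtain ⟨a, -, rfl⟩ := Finset.mem_map.1 hz
  obtain ⟨b, -, hb⟩ := Finset.mem_map.1 hz'
  rcases toLex_inj.1 hb with ⟨⟩

variable [Algebra ℚ R]

/-- **Addition principle for Gaussian Grassmann integrations** — the statement of
`berezinOn_gaussian_fieldSum_of_sources` without the auxiliary source block (obtained by embedding
`J` into `J ⊕ₗ (ι ⊕ₗ ι)`, where the second summand carries the sources, and pulling back along the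
injective embedding of Grassmann algebras): for fermion blocks `ψ₁ = e₁(·)` before `ψ₂ = e₂(·)` with
weights `e^{ψ̄₁A₁ψ₁}`, `e^{ψ̄₂A₂ψ₂}`, `A⁻¹ = A₁⁻¹ + A₂⁻¹` (all determinants units) and every `g` in the
algebra of the `ψ₁`-fields,
`∫ dθ_{s₁∪s₂} e^{ψ̄₁A₁ψ₁} e^{ψ̄₂A₂ψ₂} g(ψ₁ + ψ₂) = (ε det A₁ det A₂ (det A)⁻¹) ∫ dθ_{s₁} e^{ψ̄₁Aψ₁} g(ψ₁)`
(Benfatto–Giuliani–Mastropietro 2006, (2.12); Mastropietro 2008, (2.39)).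
[cite: BenfattoGiulianiMastropietro2006, (2.12)] -/
theorem berezinOn_gaussian_fieldSum (e₁ e₂ : ι ⊕ₗ ι ↪o J)
    (h12 : ∀ x ∈ Finset.univ.map e₁.toEmbedding, ∀ y ∈ Finset.univ.map e₂.toEmbedding, x < y)
    (A₁ A₂ A : Matrix ι ι R) (hA₁ : IsUnit A₁.det) (hA₂ : IsUnit A₂.det) (hA : IsUnit A.det)
    (hAinv : A⁻¹ = A₁⁻¹ + A₂⁻¹) {g : GrassmannAlgebra R J}
    (hg : g ∈ spectatorSubalgebra R (Finset.univ.map e₁.toEmbedding)ᶜ) :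
    berezinOn R (Finset.univ.map e₁.toEmbedding ∪ Finset.univ.map e₂.toEmbedding)
        (ExteriorAlgebra.map (Function.ExtendByZero.linearMap R e₁) (grassmannExp (quadratic R A₁)) *
          ExteriorAlgebra.map (Function.ExtendByZero.linearMap R e₂) (grassmannExp (quadratic R A₂)) *
          ExteriorAlgebra.map (1 + fieldShift R e₁ e₂) g) =
      ((-1 : R) ^ (Fintype.card ι * (Fintype.card ι - 1) / 2) * A₁.det * A₂.det * Ring.inverse A.det) •
        berezinOn R (Finset.univ.map e₁.toEmbedding)
          (ExteriorAlgebra.map (Function.ExtendByZero.linearMap R e₁) (grassmannExp (quadratic R A)) * g) := by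
  set f : J ↪o J ⊕ₗ (ι ⊕ₗ ι) := inlLex J (ι ⊕ₗ ι) with hf
  set e₀ : ι ⊕ₗ ι ↪o J ⊕ₗ (ι ⊕ₗ ι) := inrLex J (ι ⊕ₗ ι) with he₀
  have hs : ∀ e : ι ⊕ₗ ι ↪o J, (Finset.univ.map e.toEmbedding).map f.toEmbedding =
      Finset.univ.map (e.trans f).toEmbedding := fun e => by
    rw [Finset.map_map]; rfl
  have h01 : Disjoint (Finset.univ.map e₀.toEmbedding) (Finset.univ.map (e₁.trans f).toEmbedding) :=
    disjoint_map_inrLex_map_trans_inlLex e₁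
  have h02 : Disjoint (Finset.univ.map e₀.toEmbedding) (Finset.univ.map (e₂.trans f).toEmbedding) :=
    disjoint_map_inrLex_map_trans_inlLex e₂
  have h12' : ∀ x ∈ Finset.univ.map (e₁.trans f).toEmbedding,
      ∀ y ∈ Finset.univ.map (e₂.trans f).toEmbedding, x < y := by
    intro x hx y hy
    rw [← hs] at hx hy
    obtain ⟨a, ha, rfl⟩ := Finset.mem_map.1 hx
    obtain ⟨b, hb, rfl⟩ := Finset.mem_map.1 hy
    exact f.lt_iff_lt.2 (h12 a ha b hb)
  have hg' : ExteriorAlgebra.map (Function.ExtendByZero.linearMap R f) g ∈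
      spectatorSubalgebra R (Finset.univ.map (e₁.trans f).toEmbedding)ᶜ := by
    rw [← hs]
    exact map_extendByZero_mem_spectatorSubalgebra_compl R f hg
  have key := berezinOn_gaussian_fieldSum_of_sources R e₀ (e₁.trans f) (e₂.trans f) h01 h02 h12'
    A₁ A₂ A hA₁ hA₂ hA hAinv hg'
  rw [← hs, ← hs, ← Finset.map_union, ← map_extendByZero_map_extendByZero R e₁ f,
    ← map_extendByZero_map_extendByZero R e₂ f, ← map_extendByZero_map_extendByZero R e₁ f,
    ← map_extendByZero_map_one_add_fieldShift, ← map_mul, ← map_mul, ← map_mul,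
    berezinOn_map_map_extendByZero, berezinOn_map_map_extendByZero, ← map_smul] at key
  exact map_extendByZero_injective R f.injective key

/-- The addition principle with the normalisation of the summed covariance multiplied out:
`det A • ∫ dθ_{s₁∪s₂} e^{ψ̄₁A₁ψ₁} e^{ψ̄₂A₂ψ₂} g(ψ₁+ψ₂) = (ε det A₁ det A₂) • ∫ dθ_{s₁} e^{ψ̄₁Aψ₁} g(ψ₁)`,
i.e. `⟨g(ψ₁ + ψ₂)⟩_{A₁⁻¹, A₂⁻¹} = ⟨g⟩_{A₁⁻¹ + A₂⁻¹}` after dividing by `(ε det A₁)(ε det A₂)(ε det A)`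
(BGM 2006, (2.12); Mastropietro 2008, (2.39)). [cite: BenfattoGiulianiMastropietro2006, (2.12)] -/
theorem det_smul_berezinOn_gaussian_fieldSum (e₁ e₂ : ι ⊕ₗ ι ↪o J)
    (h12 : ∀ x ∈ Finset.univ.map e₁.toEmbedding, ∀ y ∈ Finset.univ.map e₂.toEmbedding, x < y)
    (A₁ A₂ A : Matrix ι ι R) (hA₁ : IsUnit A₁.det) (hA₂ : IsUnit A₂.det) (hA : IsUnit A.det)
    (hAinv : A⁻¹ = A₁⁻¹ + A₂⁻¹) {g : GrassmannAlgebra R J}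
    (hg : g ∈ spectatorSubalgebra R (Finset.univ.map e₁.toEmbedding)ᶜ) :
    A.det • berezinOn R (Finset.univ.map e₁.toEmbedding ∪ Finset.univ.map e₂.toEmbedding)
        (ExteriorAlgebra.map (Function.ExtendByZero.linearMap R e₁) (grassmannExp (quadratic R A₁)) *
          ExteriorAlgebra.map (Function.ExtendByZero.linearMap R e₂) (grassmannExp (quadratic R A₂)) *
          ExteriorAlgebra.map (1 + fieldShift R e₁ e₂) g) =
      ((-1 : R) ^ (Fintype.card ι * (Fintype.card ι - 1) / 2) * A₁.det * A₂.det) •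
        berezinOn R (Finset.univ.map e₁.toEmbedding)
          (ExteriorAlgebra.map (Function.ExtendByZero.linearMap R e₁) (grassmannExp (quadratic R A)) * g) := by
  rw [berezinOn_gaussian_fieldSum R e₁ e₂ h12 A₁ A₂ A hA₁ hA₂ hA hAinv hg, smul_smul]
  congr 1
  rw [show A.det * ((-1 : R) ^ (Fintype.card ι * (Fintype.card ι - 1) / 2) * A₁.det * A₂.det *
      Ring.inverse A.det) = (-1 : R) ^ (Fintype.card ι * (Fintype.card ι - 1) / 2) * A₁.det * A₂.det *
      (A.det * Ring.inverse A.det) by ring, Ring.mul_inverse_cancel _ hA, mul_one]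

end Transport
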